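import Literature.AlgebraicGeometry.Resolution.Blowups
import Literature.AlgebraicGeometry.Resolution.BlowupsProperProofs
import HarnessLib

/-!
# Blow-ups: conventional discharge name of the named fact `Stacks02NS` (deprecated alias)

Topic: `Literature/AlgebraicGeometry/Resolution`. Sibling file of `Blowups.lean`.

The named fact `Stacks02NS` of `Blowups.lean` (**blowing ups along ideal sheaves of finite type are
proper**; The Stacks Project, Tag 02NS = Lemma 31.32.13 (1); Görtz–Wedhorn I, Prop. 13.96 (1) with
Cor. 13.72) is PROVED by `stacks02NS_holds` in `BlowupsProperProofs.lean` — that theorem is the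
discharge and the one to use.

This file only records the conventional D-0014 discharge name `<Fact>_holds` = `Stacks02NS_holds`,
as a **deprecated alias** of `stacks02NS_holds` (work item dedup-00180, 2026-08-15: the alias
restates `stacks02NS_holds` verbatim and has no users, so it survives only as a NAME — the
named-fact census and the `<Fact>_holds` lookup convention key on the exact spelling
`Stacks02NS_holds`; the deprecation redirects any use to `stacks02NS_holds`). A further alias-probe
hit on this declaration is therefore expected and moot. Do not add results here; extend
`BlowupsProperProofs.lean` instead.

* `Stacks02NS_holds : Stacks02NS` — deprecated alias of `stacks02NS_holds` (use the latter).

## Sources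

* The Stacks Project, Tag 02NS (Lemma 31.32.13). [StacksProject]
* U. Görtz, T. Wedhorn, *Algebraic Geometry I: Schemes*, 2nd ed., Springer 2020, Prop. 13.92,
  Prop. 13.96 (1), Cor. 13.72. [GortzWedhorn2020]
-/

namespace Literature.AlgebraicGeometry.Resolution

universe u

/-- Deprecated alias — use `stacks02NS_holds` (`BlowupsProperProofs.lean`), which IS the proof of
the named fact `Stacks02NS` (blowing ups along finite-type ideal sheaves are proper); this is only
its conventional discharge name `<Fact>_holds`.
[cite: StacksProject, Tag 02NS] [cite: GortzWedhorn2020, Prop. 13.96 (1) with Cor. 13.72] -/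
@[deprecated stacks02NS_holds (since := "2026-08-15")]
theorem Stacks02NS_holds : Stacks02NS.{u} :=
  stacks02NS_holds

end Literature.AlgebraicGeometry.Resolution
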